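import Summits.ResolutionOfSingularities.ResolutionOfSingularities.Theorems.MarkedTransferCampaignW46MohWindowShadeAnchorCore
import Summits.ResolutionOfSingularities.ResolutionOfSingularities.Theorems.MarkedTransferCampaignW46MohWindowSurfacePermissible
import Literature.AlgebraicGeometry.Resolution.NearPointTauOrigin
import Literature.AlgebraicGeometry.Resolution.NearPointTauMonotone
import Literature.AlgebraicGeometry.Resolution.BlowupOffCentre
import HarnessLib

/-!
# [OURS · L1 W4.6 rung (iii-2), ENTRANCE DOOR, brick 4a] Chart bookkeeping for polynomial anchors under a point blow-up: recentring at a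
# rational point, the impossible `z`-chart, and the transport off the centre

Cell `res-hironaka`, LADDER-RESOLUTION rung L (D-0089), slot W4.6 rung (iii); seat res-L1-s46-pv-6 (gen 4). Host route MarkedTransfer,
`--supports stmt-ResolutionOfSingularities-16155 --as helper`; kind proof (no definition).

WHAT. Ingredients of the scheme-level step of the ENTRANCE DOOR (next brick `…MohWindowShadeAnchorStep.lean`):
* `exists_origin_chart_of_rational` — for a blow-up `π` along `Y` with `𝓘_{Y,πx′} = 𝔪 = (c₀, c₁, c₂)`, a point `x′` in the chart of `c_m`
  (`π^♯ c_l = π^♯ c_m · ρ_l`) whose recentred quotients are RATIONAL (`ρ_l − π^♯ ã_l ∈ 𝔪_{x′}`), the stalk `𝒪_{X′,x′}` is presented by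
  the chart of index `m` of the recentred system `shiftRsop c m ã` AT ITS ORIGIN (all quotients in the prime) — the pattern of the
  tree's `IsBlowup.exists_origin_chart_of_isNear_point` with rationality in place of nearness;
* `false_of_zChart` — with an anchor `J = (z^p + F(x, y))`, `ord F ≥ p`, a point of the `z`-chart with both `x/z, y/z ∈ 𝔪` is not a
  point of order `≥ p` of the controlled transform (the pulled-back equation is `z^p ·` unit);
* `exists_anchor_offCentre` — at a point NOT over the centre the stalk map is an isomorphism and the controlled transform is the total
  transform (tree `BlowupOffCentre`): the anchor is transported verbatim, same model state;
* ring lemmas `range_fin3`, `eq_zero_of_map_mem_maximalIdeal`, `eval₂_mul_mem_span_pow_mul`.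

HONEST FRAMING. Nothing here is a statement of H. Hironaka's manuscript [Hironaka2017] (2017-03-23; Th. 16.6 p.84 — scope only, under
adjudication) and nothing asserts that any statement of it holds. AI-written; AI review is weaker than expert review. No `sorry`; axioms
standard. References: The Stacks Project, Tag 0804 (affine blow-up algebra, charts); Bierstone–Grigoriev–Milman–Włodarczyk 2011 §3.2
(transforms off the centre); H. Hauser, Bull. AMS 47 (2010) §F. [StacksProject] [BierstoneGrigorievMilmanWlodarczyk2011] [Hauser2010] [folklore]
-/

noncomputable section

set_option linter.dupNamespace false -- mandated namespace of this single-conjunct summit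

open CategoryTheory AlgebraicGeometry TopologicalSpace IsLocalRing MvPolynomial

namespace Summit.ResolutionOfSingularities.ResolutionOfSingularities.Theorems

namespace CampaignW46

namespace MohWindowShadeAnchorChart

open Literature.AlgebraicGeometry.Resolution
open Literature.AlgebraicGeometry.Resolution.PointBlowup
open Literature.AlgebraicGeometry.Resolution.Hauser2010
open Literature.AlgebraicGeometry.Hironaka2017.S02Preliminaries
open Literature.AlgebraicGeometry.Hironaka2017.Datum
open Literature.AlgebraicGeometry.Hironaka2017.S16Proof
open Scheme.IdealSheafData

universe u
/-! ## §1 Ring-level preliminaries -/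

section Ring

variable {R : Type u} [CommRing R]

omit [CommRing R] in
/-- The range of a family indexed by `Fin 3`. [folklore] -/
theorem range_fin3 (f : Fin 3 → R) : Set.range f = {f 0, f 1, f 2} := by
  ext r
  simp only [Set.mem_range, Set.mem_insert_iff, Set.mem_singleton_iff]
  constructor
  · rintro ⟨k, rfl⟩
    fin_cases k
    · exact Or.inl rfl
    · exact Or.inr (Or.inl rfl)
    · exact Or.inr (Or.inr rfl)
  · rintro (rfl | rfl | rfl)
    · exact ⟨0, rfl⟩
    · exact ⟨1, rfl⟩
    · exact ⟨2, rfl⟩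

/-- A constant from a field lying in the maximal ideal of a local ring is zero. [folklore] -/
theorem eq_zero_of_map_mem_maximalIdeal [IsLocalRing R] {K : Type*} [Field K] (κ : K →+* R) {q : K}
    (h : κ q ∈ maximalIdeal R) : q = 0 := by
  by_contra hq
  exact (IsLocalRing.mem_maximalIdeal _).mp h ((isUnit_iff_ne_zero.mpr hq).map κ)

/-- **Monomials of degree `≥ n` at a point of the `z`-chart.** For a polynomial `G` all of whose monomials have degree `≥ n` and
`≥ 1`, `G(T·u) ∈ (T^n) · I` whenever all `u_l ∈ I`. [folklore] -/
theorem eval₂_mul_mem_span_pow_mul {S : Type*} [CommRing S] {τ : Type*} (f : S →+* R) (T : R) (I : Ideal R) {u : τ → R}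
    (hu : ∀ l, u l ∈ I) (G : MvPolynomial τ S) {n : ℕ} (hn : ∀ d ∈ G.support, n ≤ d.degree)
    (h1 : ∀ d ∈ G.support, 1 ≤ d.degree) :
    eval₂ f (fun l => T * u l) G ∈ Ideal.span {T ^ n} * I := by
  classical
  rw [MvPolynomial.eval₂_eq]
  refine Ideal.sum_mem _ fun d hd => Ideal.mul_mem_left _ _ ?_
  rw [Finset.prod_congr rfl (fun l _ => mul_pow T (u l) (d l)), Finset.prod_mul_distrib, Finset.prod_pow_eq_pow_sum]
  have hdeg : ∑ i ∈ d.support, d i = d.degree := rfl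
  rw [hdeg, ← Nat.add_sub_cancel' (hn d hd), pow_add, mul_assoc]
  refine Ideal.mul_mem_mul (Ideal.mem_span_singleton_self _) (Ideal.mul_mem_left _ _ ?_)
  have hprod : ∏ i ∈ d.support, u i ^ d i ∈ ∏ i ∈ d.support, I ^ d i :=
    Ideal.prod_mem_prod fun i _ => Ideal.pow_mem_pow (hu i) _
  rw [Finset.prod_pow_eq_pow_sum, hdeg] at hprod
  exact Ideal.pow_le_self (by have := h1 d hd; omega) hprod

end Ring

/-! ## §2 Re-presenting the stalk of the blow-up at a rational point as the ORIGIN of the chart of a recentred system -/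

section Chart

variable {X X' : Scheme.{u}} {π : X' ⟶ X}

/-- **Recentring.** Let `π` be a blow-up along `Y` with `𝓘_{Y,πx′} = 𝔪 = (c₀, c₁, c₂)`; suppose `x′` lies in the chart of `c_m`
(`π^♯ c_l = π^♯ c_m · ρ_l`) with RATIONAL affine coordinates: constants `a_l` (`l ≠ m`) with `ρ_l − π^♯ ã_l ∈ 𝔪_{x′}` where `ã_l` are
their lifts downstairs. Then w.r.t. the recentred system `c̃ = shiftRsop c m ã` the stalk `𝒪_{X′,x′}` is presented by the chart of
index `m` AT ITS ORIGIN: all quotients `ẽ_l`, `l ≠ m`, lie in the prime `𝔴`. (The pattern of the tree's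
`IsBlowup.exists_origin_chart_of_isNear_point`, with rationality in place of nearness.) [cite: StacksProject, Tag 0804] -/
theorem exists_origin_chart_of_rational {Y : Closeds X} (hπ : IsBlowup π (vanishingIdeal Y)) {x' : X'} {c : Fin 3 → X.presheaf.stalk (π x')}
    (hcY : Ideal.span (Set.range c) = stalkIdeal (vanishingIdeal Y) (π x')) (m : Fin 3)
    (hm0 : (π.stalkMap x').hom (c m) ≠ 0) (ρ : Fin 3 → X'.presheaf.stalk x')
    (hρ : ∀ l, (π.stalkMap x').hom (c l) = (π.stalkMap x').hom (c m) * ρ l)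
    (ã : {l : Fin 3 // l ≠ m} → X.presheaf.stalk (π x'))
    (hã : ∀ l (hl : l ≠ m), ρ l - (π.stalkMap x').hom (ã ⟨l, hl⟩) ∈ maximalIdeal (X'.presheaf.stalk x'))
    [IsDomain (X'.presheaf.stalk x')] (c₂ : Fin 3 → X.presheaf.stalk (π x')) (hc₂ : c₂ = shiftRsop c m ã) :
    ∃ (𝔴 : PrimeSpectrum (chartRing c₂ m)) (χ : chartRing c₂ m →+* X'.presheaf.stalk x'),
      (∀ a, χ (chartBase c₂ m a) = (π.stalkMap x').hom a) ∧
      @IsLocalization.AtPrime _ _ (X'.presheaf.stalk x') _ χ.toAlgebra 𝔴.asIdeal _ ∧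
      𝔴.asIdeal.comap (chartBase c₂ m) = maximalIdeal _ ∧
      (∀ l, l ≠ m → chartGen c₂ m l ∈ 𝔴.asIdeal) ∧
      ∀ l (hl : l ≠ m), χ (chartGen c₂ m l) = ρ l - (π.stalkMap x').hom (ã ⟨l, hl⟩) := by
  classical
  set ψ := (π.stalkMap x').hom with hψ
  have hc₂Y : Ideal.span (Set.range c₂) = stalkIdeal (vanishingIdeal Y) (π x') := by
    rw [hc₂, span_range_shiftRsop, hcY]
  obtain ⟨j₂, 𝔴₂, χ₂, hχ₂, hloc₂, h𝔴₂⟩ := hπ.exists_reesChart_stalk x' c₂ hc₂Y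
  have hu₂ := stalkMap_apply_eq_mul_chartGen j₂ χ₂ hχ₂
  -- images of the recentred generators
  have hσc₂ : ∀ l (hl : l ≠ m), ψ (c₂ l) = ψ (c m) * (ρ l - ψ (ã ⟨l, hl⟩)) := by
    intro l hl
    rw [hc₂, shiftRsop_of_ne c m ã hl, map_sub, map_mul, hρ l]
    ring
  have hσc₂m : ψ (c₂ m) = ψ (c m) := by rw [hc₂, shiftRsop_self]
  -- (3) the chart index is `m`
  have hj₂ : j₂ = m := by
    by_contra hne
    have h1 : ψ (c m) = ψ (c m) * ((ρ j₂ - ψ (ã ⟨j₂, hne⟩)) * χ₂ (chartGen c₂ j₂ m)) := by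
      have h := hu₂ m
      rw [hσc₂m, hσc₂ j₂ hne, mul_assoc] at h
      exact h
    have hm : (ρ j₂ - ψ (ã ⟨j₂, hne⟩)) * χ₂ (chartGen c₂ j₂ m) ∈ maximalIdeal (X'.presheaf.stalk x') :=
      Ideal.mul_mem_right _ _ (hã j₂ hne)
    have hunit : IsUnit (1 - (ρ j₂ - ψ (ã ⟨j₂, hne⟩)) * χ₂ (chartGen c₂ j₂ m)) :=
      IsLocalRing.isUnit_one_sub_self_of_mem_nonunits _ ((IsLocalRing.mem_maximalIdeal _).mp hm)
    have h2 : ψ (c m) * (1 - (ρ j₂ - ψ (ã ⟨j₂, hne⟩)) * χ₂ (chartGen c₂ j₂ m)) = 0 := by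
      rw [mul_sub, mul_one, ← h1, sub_self]
    rcases mul_eq_zero.mp h2 with h | h
    · exact hm0 h
    · exact hunit.ne_zero h
  subst hj₂
  -- (4) the recentred quotients lie in `𝔴₂`, and their values
  have hval : ∀ l (hl : l ≠ j₂), χ₂ (chartGen c₂ j₂ l) = ρ l - ψ (ã ⟨l, hl⟩) := by
    intro l hl
    have h1 : ψ (c j₂) * (ρ l - ψ (ã ⟨l, hl⟩)) = ψ (c j₂) * χ₂ (chartGen c₂ j₂ l) := by
      rw [← hσc₂ l hl, ← hσc₂m]; exact hu₂ l
    exact (mul_left_cancel₀ hm0 h1).symm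
  have he₂ : ∀ l, l ≠ j₂ → chartGen c₂ j₂ l ∈ 𝔴₂.asIdeal := by
    intro l hl
    rw [← @IsLocalization.AtPrime.to_map_mem_maximal_iff (chartRing c₂ j₂) _ (X'.presheaf.stalk x') _
      χ₂.toAlgebra 𝔴₂.asIdeal _ hloc₂ _ inferInstance]
    change χ₂ (chartGen c₂ j₂ l) ∈ maximalIdeal _
    rw [hval l hl]
    exact hã l hl
  exact ⟨𝔴₂, χ₂, hχ₂, hloc₂, h𝔴₂, he₂, hval⟩

end Chart

/-! ## §3 The impossible `z`-chart -/

variable {p : ℕ} [Fact p.Prime] {K : Type u} [Field K] [CharP K p]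
variable {σ : Type} [DecidableEq σ] {j : σ}

omit [CharP K p] in
/-- **The `z`-chart alone is impossible at a singular point.** With the anchor `J_ξ = (z^p + F(x, y))`, `ord F ≥ p`, if `ξ′` lies in the
chart of `z` with BOTH quotients `x/z, y/z` in `𝔪_{ξ′}`, then `J′_{ξ′} = 𝒪` (the pulled-back equation is `z^p · (unit)`), so `ξ′`
is not a point of order `≥ p ≥ 1` of `J′`. [cite: Hauser2010, §F (chart expressions of a point blowup)] -/
theorem false_of_zChart {R L : Type u} [CommRing R] [CommRing L] [IsLocalRing L] [IsDomain L] (ψ : R →+* L) (κ : K →+* R)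
    {x y z : R} (s : State σ K) (hdeg : ∀ d ∈ s.F.support, p ≤ d.degree) {q₀ q₁ : L}
    (hx : ψ x = ψ z * q₀) (hy : ψ y = ψ z * q₁) (hq₀ : q₀ ∈ maximalIdeal L) (hq₁ : q₁ ∈ maximalIdeal L) (hz0 : ψ z ≠ 0)
    {J' : Ideal L}
    (hJ' : J' = Submodule.colon (Ideal.span {ψ (z ^ p + eval₂ κ (fun l => if l = j then x else y) s.F)})
      ((Ideal.span {ψ z} ^ p : Ideal L) : Set L))
    (hsing : J' ≤ maximalIdeal L ^ p) : False := by
  classical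
  have hp1 : 1 ≤ p := (Fact.out : p.Prime).one_lt.le
  -- `ψ (F(x, y)) ∈ (ψ z)^p · 𝔪`
  have hmem : ψ (eval₂ κ (fun l => if l = j then x else y) s.F) ∈ Ideal.span {ψ z ^ p} * maximalIdeal L := by
    rw [eval₂_comp_left ψ κ]
    have hfun : (ψ ∘ fun l => if l = j then x else y) = fun l => ψ z * (if l = j then q₀ else q₁) := by
      funext l
      simp only [Function.comp_apply]
      split_ifs
      · exact hx
      · exact hy
    rw [hfun]
    refine eval₂_mul_mem_span_pow_mul (ψ.comp κ) (ψ z) (maximalIdeal L) (fun l => ?_) s.F hdeg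
      (fun d hd => le_trans hp1 (hdeg d hd))
    show (if l = j then q₀ else q₁) ∈ maximalIdeal L
    split_ifs
    · exact hq₀
    · exact hq₁
  obtain ⟨m, hm, hmeq⟩ := Ideal.mem_span_singleton_mul.mp hmem
  -- the transform is the unit ideal
  have hg : ψ (z ^ p + eval₂ κ (fun l => if l = j then x else y) s.F) = ψ z ^ p * (1 + m) := by
    rw [map_add, map_pow, ← hmeq]; ring
  have hunit : IsUnit (1 + m) := by
    have := IsLocalRing.isUnit_one_sub_self_of_mem_nonunits (-m)
      ((IsLocalRing.mem_maximalIdeal _).mp ((maximalIdeal L).neg_mem hm))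
    rwa [sub_neg_eq_add] at this
  rw [hg, MohWindowSurface.colon_span_pow_mul (mem_nonZeroDivisors_of_ne_zero hz0)] at hJ'
  have htop : J' = ⊤ := by rw [hJ']; exact Ideal.span_singleton_eq_top.mpr hunit
  rw [htop] at hsing
  exact (maximalIdeal.isMaximal L).ne_top (top_le_iff.mp (hsing.trans (Ideal.pow_le_self (by omega))))

/-! ## §4 Off the centre: the anchor is transported verbatim -/

/-- **OFF THE CENTRE.** [OURS · L1 W4.6 rung (iii-2)] NOT a statement of the manuscript. For a blow-up `π` of the ambient datum along
`D` and a point `ξ′` NOT over `D`, the stalk map `𝒪_{Z,πξ′} → 𝒪_{Z′,ξ′}` is an isomorphism and the controlled transform is the total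
transform there (tree `BlowupOffCentre`); so a polynomial anchor `J_{πξ′} = (z^p + F_s(x, y))` is carried to the anchor
`J′_{ξ′} = (z′^p + F_s(x′, y′))` with the SAME state `s` (`x′ = π^♯ x`, …). [cite: BierstoneGrigorievMilmanWlodarczyk2011, §3.2] -/
theorem exists_anchor_offCentre {A A' : AmbientDatum p K} {E : IdealExponent A.Z} {D : Closeds A.Z} (π : A'.Z ⟶ A.Z)
    (hπ : IsBlowup π (vanishingIdeal D)) {ξ' : A'.Z} (hoff : π.base ξ' ∉ (D : Set A.Z))
    (κ : K →+* A.Z.presheaf.stalk (π.base ξ')) (κ' : K →+* A'.Z.presheaf.stalk ξ')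
    (hκκ' : ∀ l, (π.stalkMap ξ').hom (κ l) = κ' l)
    {x y z : A.Z.presheaf.stalk (π.base ξ')} (hxyz : Ideal.span {x, y, z} = maximalIdeal _) (s : State σ K)
    (hJ : stalkIdeal E.J (π.base ξ') = Ideal.span {z ^ p + eval₂ κ (fun l => if l = j then x else y) s.F}) :
    ∃ x' y' z' : A'.Z.presheaf.stalk ξ', Ideal.span {x', y', z'} = maximalIdeal _ ∧
      stalkIdeal (E.transform π D).J ξ' = Ideal.span {z' ^ p + eval₂ κ' (fun l => if l = j then x' else y') s.F} := by
  classical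
  haveI : IsLocallyNoetherian A'.Z := by
    haveI := A'.smooth
    exact LocallyOfFiniteType.isLocallyNoetherian A'.hom
  set ψ := (π.stalkMap ξ').hom with hψ
  have hnot : π.base ξ' ∉ (vanishingIdeal D).support := by
    rw [← SetLike.mem_coe, coe_support_vanishingIdeal]; exact hoff
  have h1 : stalkIdeal (E.transform π D).J ξ' = (stalkIdeal E.J (π.base ξ')).map ψ := by
    show stalkIdeal (controlledTransform π (vanishingIdeal D) E.J E.b) ξ' = _
    rw [hπ.stalkIdeal_controlledTransform_of_not_mem E.J E.b hnot, stalkIdeal_comap_eq_map_stalkMap]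
  haveI := hπ.isIso_stalkMap_of_not_mem_support hnot
  have hsurj : Function.Surjective ψ :=
    (asIso (π.stalkMap ξ')).commRingCatIsoToRingEquiv.surjective
  refine ⟨ψ x, ψ y, ψ z, ?_, ?_⟩
  · have h := IsLocalRing.map_maximalIdeal_of_surjective ψ hsurj
    rw [← hxyz, Ideal.map_span] at h
    rw [← h]
    congr 1
    ext r
    simp only [Set.mem_image, Set.mem_insert_iff, Set.mem_singleton_iff]
    constructor
    · rintro (rfl | rfl | rfl)
      · exact ⟨x, Or.inl rfl, rfl⟩
      · exact ⟨y, Or.inr (Or.inl rfl), rfl⟩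
      · exact ⟨z, Or.inr (Or.inr rfl), rfl⟩
    · rintro ⟨r', hr', rfl⟩
      rcases hr' with rfl | rfl | rfl
      · exact Or.inl rfl
      · exact Or.inr (Or.inl rfl)
      · exact Or.inr (Or.inr rfl)
  · rw [h1, hJ, Ideal.map_span, Set.image_singleton, map_add, map_pow, eval₂_comp_left ψ κ]
    have hκ'e : ψ.comp κ = κ' := RingHom.ext hκκ'
    have hfun : (ψ ∘ fun l => if l = j then x else y) = fun l => if l = j then ψ x else ψ y := by
      funext l
      simp only [Function.comp_apply]
      split_ifs <;> rfl
    rw [hκ'e, hfun]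

end MohWindowShadeAnchorChart

end CampaignW46

end Summit.ResolutionOfSingularities.ResolutionOfSingularities.Theorems

end
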